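import Mathlib
import Summits.Ventures.HodgeRepro2.Hypothesis
import Summits.Ventures.HodgeRepro2.InvariantFormsGroup

/-!
# The spaces of invariant 1-forms, and `NonVanishingInput ⇒ IrregularityAtLeast 2`

The 1-form predicates of `Hypothesis.lean` — `IsHolomorphicOneForm`, `IsClosedOneForm`,
`IsInvariantUnder α` — are linear conditions, so the forms entering `NonVanishingInput` and
`IrregularityAtLeast` form `ℂ`-subspaces of `(Fin 2 → ℂ) → Fin 2 → ℂ`:

* `IsHolomorphicOneForm.add` / `.smul`, `IsClosedOneForm.add` / `.smul` (on holomorphic forms: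
  `fderiv` is additive at interior points of the open ball), `IsInvariantUnder.add` / `.smul`.
* `holInvariantForms τ₁ Q Γ`, `closedInvariantForms τ₁ Q Γ`: the submodules of holomorphic
  [closed] 1-forms invariant under `realEmbedding K τ₁ Q γ` for all `γ ∈ Γ`.
* `irregularityAtLeast_iff`: `IrregularityAtLeast K τ₁ Q Γ k` is «`k` linearly independent
  vectors of `holInvariantForms τ₁ Q Γ`».
* `nonVanishingInput_iff`: `NonVanishingInput` is «a finite-index `Γ ≤ Γ_1` and
  `q₁ q₂ ∈ closedInvariantForms τ₁ Q Γ` with `WedgeNonzero q₁ q₂`».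
* `wedgeNonzero_smul_add`, `WedgeNonzero.symm`: `WedgeNonzero` depends only on the plane spanned;
  **`WedgeNonzero.linearIndependent`**: a non-zero wedge forces linear independence; hence
  **`NonVanishingInput.exists_irregularityAtLeast_two`**: `NonVanishingInput K τ₁ H 𝔪 Q` gives a
  finite-index `Γ ≤ Γ_1` with `IrregularityAtLeast K τ₁ Q Γ 2` (the consistency of the two shapes).

Everything is proved; no new axioms. What stays prose: the converse — two independent forms need
not wedge to a non-zero 2-form; that is the content of the non-vanishing input (N).
-/

namespace Summit.Ventures.HodgeRepro2.ShimuraData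

open Matrix

section Linear

/-! ### The predicates are linear -/

/-- Sums of holomorphic 1-forms are holomorphic. -/
theorem IsHolomorphicOneForm.add {q₁ q₂ : (Fin 2 → ℂ) → Fin 2 → ℂ} (h₁ : IsHolomorphicOneForm q₁)
    (h₂ : IsHolomorphicOneForm q₂) : IsHolomorphicOneForm (q₁ + q₂) :=
  DifferentiableOn.add h₁ h₂

/-- Scalar multiples of holomorphic 1-forms are holomorphic. -/
theorem IsHolomorphicOneForm.smul {q : (Fin 2 → ℂ) → Fin 2 → ℂ} (h : IsHolomorphicOneForm q)
    (c : ℂ) : IsHolomorphicOneForm (c • q) :=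
  DifferentiableOn.const_smul h c

/-- The zero form is holomorphic. -/
theorem isHolomorphicOneForm_zero : IsHolomorphicOneForm 0 :=
  differentiableOn_const 0

/-- Each coordinate of a holomorphic 1-form is differentiable at interior points of the ball. -/
theorem IsHolomorphicOneForm.differentiableAt_apply {q : (Fin 2 → ℂ) → Fin 2 → ℂ}
    (h : IsHolomorphicOneForm q) {z : Fin 2 → ℂ} (hz : z ∈ ball₂) (k : Fin 2) :
    DifferentiableAt ℂ (fun w => q w k) z :=
  differentiableAt_pi.1 (h.differentiableAt (isOpen_ball₂.mem_nhds hz)) k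

/-- Sums of closed holomorphic 1-forms are closed. -/
theorem IsClosedOneForm.add {q₁ q₂ : (Fin 2 → ℂ) → Fin 2 → ℂ} (h₁q : IsHolomorphicOneForm q₁)
    (h₂q : IsHolomorphicOneForm q₂) (h₁ : IsClosedOneForm q₁) (h₂ : IsClosedOneForm q₂) :
    IsClosedOneForm (q₁ + q₂) := by
  intro z hz
  have e0 : (fun w => (q₁ + q₂) w 0) = fun w => q₁ w 0 + q₂ w 0 := rfl
  have e1 : (fun w => (q₁ + q₂) w 1) = fun w => q₁ w 1 + q₂ w 1 := rfl
  rw [e0, e1, fderiv_fun_add (h₁q.differentiableAt_apply hz 0) (h₂q.differentiableAt_apply hz 0),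
    fderiv_fun_add (h₁q.differentiableAt_apply hz 1) (h₂q.differentiableAt_apply hz 1),
    _root_.add_apply, _root_.add_apply, h₁ z hz, h₂ z hz]

/-- Scalar multiples of closed holomorphic 1-forms are closed. -/
theorem IsClosedOneForm.smul {q : (Fin 2 → ℂ) → Fin 2 → ℂ} (hq : IsHolomorphicOneForm q)
    (h : IsClosedOneForm q) (c : ℂ) : IsClosedOneForm (c • q) := by
  intro z hz
  have e0 : (fun w => (c • q) w 0) = fun w => c • q w 0 := rfl
  have e1 : (fun w => (c • q) w 1) = fun w => c • q w 1 := rfl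
  rw [e0, e1, fderiv_fun_const_smul (hq.differentiableAt_apply hz 0) c,
    fderiv_fun_const_smul (hq.differentiableAt_apply hz 1) c, _root_.smul_apply,
    _root_.smul_apply, h z hz]

/-- The zero form is closed. -/
theorem isClosedOneForm_zero : IsClosedOneForm 0 := by
  intro z _
  simp

/-- Sums of `α`-invariant 1-forms are `α`-invariant. -/
theorem IsInvariantUnder.add {α : Matrix (Fin 3) (Fin 3) ℂ} {q₁ q₂ : (Fin 2 → ℂ) → Fin 2 → ℂ}
    (h₁ : IsInvariantUnder α q₁) (h₂ : IsInvariantUnder α q₂) : IsInvariantUnder α (q₁ + q₂) := by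
  intro z hz j
  simp only [Pi.add_apply, add_mul, Finset.sum_add_distrib]
  rw [h₁ z hz j, h₂ z hz j]

/-- Scalar multiples of `α`-invariant 1-forms are `α`-invariant. -/
theorem IsInvariantUnder.smul {α : Matrix (Fin 3) (Fin 3) ℂ} {q : (Fin 2 → ℂ) → Fin 2 → ℂ}
    (h : IsInvariantUnder α q) (c : ℂ) : IsInvariantUnder α (c • q) := by
  intro z hz j
  simp only [Pi.smul_apply, smul_eq_mul, mul_assoc, ← Finset.mul_sum]
  rw [h z hz j]

/-- The zero form is invariant. -/
theorem isInvariantUnder_zero (α : Matrix (Fin 3) (Fin 3) ℂ) : IsInvariantUnder α 0 := by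
  intro z _ j
  simp

end Linear

section Spaces

/-! ### The subspaces of invariant forms -/

variable {K : Type*} [Field K]

/-- The `ℂ`-space of holomorphic 1-forms on the ball invariant under `realEmbedding K τ₁ Q γ`
for every `γ ∈ Γ` — the space whose dimension `IrregularityAtLeast` bounds from below. -/
def holInvariantForms (τ₁ : K →+* ℂ) (Q : Matrix (Fin 3) (Fin 3) ℂ) (Γ : Set (GL (Fin 3) K)) :
    Submodule ℂ ((Fin 2 → ℂ) → Fin 2 → ℂ) where
  carrier := {q | IsHolomorphicOneForm q ∧ ∀ γ ∈ Γ, IsInvariantUnder (realEmbedding K τ₁ Q γ) q}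
  zero_mem' := ⟨isHolomorphicOneForm_zero, fun _ _ => isInvariantUnder_zero _⟩
  add_mem' := fun ha hb => ⟨ha.1.add hb.1, fun γ hγ => (ha.2 γ hγ).add (hb.2 γ hγ)⟩
  smul_mem' := fun c _ ha => ⟨ha.1.smul c, fun γ hγ => (ha.2 γ hγ).smul c⟩

/-- Membership in `holInvariantForms`. -/
theorem mem_holInvariantForms {τ₁ : K →+* ℂ} {Q : Matrix (Fin 3) (Fin 3) ℂ}
    {Γ : Set (GL (Fin 3) K)} {q : (Fin 2 → ℂ) → Fin 2 → ℂ} :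
    q ∈ holInvariantForms τ₁ Q Γ ↔
      IsHolomorphicOneForm q ∧ ∀ γ ∈ Γ, IsInvariantUnder (realEmbedding K τ₁ Q γ) q := Iff.rfl

/-- The `ℂ`-space of closed holomorphic 1-forms invariant under `Γ` — the space the two forms of
`NonVanishingInput` are taken from. -/
def closedInvariantForms (τ₁ : K →+* ℂ) (Q : Matrix (Fin 3) (Fin 3) ℂ)
    (Γ : Set (GL (Fin 3) K)) : Submodule ℂ ((Fin 2 → ℂ) → Fin 2 → ℂ) where
  carrier := {q | IsHolomorphicOneForm q ∧ IsClosedOneForm q ∧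
    ∀ γ ∈ Γ, IsInvariantUnder (realEmbedding K τ₁ Q γ) q}
  zero_mem' := ⟨isHolomorphicOneForm_zero, isClosedOneForm_zero, fun _ _ => isInvariantUnder_zero _⟩
  add_mem' := fun ha hb => ⟨ha.1.add hb.1, IsClosedOneForm.add ha.1 hb.1 ha.2.1 hb.2.1,
    fun γ hγ => (ha.2.2 γ hγ).add (hb.2.2 γ hγ)⟩
  smul_mem' := fun c _ ha => ⟨ha.1.smul c, ha.2.1.smul ha.1 c, fun γ hγ => (ha.2.2 γ hγ).smul c⟩

/-- Membership in `closedInvariantForms`. -/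
theorem mem_closedInvariantForms {τ₁ : K →+* ℂ} {Q : Matrix (Fin 3) (Fin 3) ℂ}
    {Γ : Set (GL (Fin 3) K)} {q : (Fin 2 → ℂ) → Fin 2 → ℂ} :
    q ∈ closedInvariantForms τ₁ Q Γ ↔ IsHolomorphicOneForm q ∧ IsClosedOneForm q ∧
      ∀ γ ∈ Γ, IsInvariantUnder (realEmbedding K τ₁ Q γ) q := Iff.rfl

/-- Closed invariant forms are invariant forms. -/
theorem closedInvariantForms_le (τ₁ : K →+* ℂ) (Q : Matrix (Fin 3) (Fin 3) ℂ)
    (Γ : Set (GL (Fin 3) K)) : closedInvariantForms τ₁ Q Γ ≤ holInvariantForms τ₁ Q Γ :=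
  fun _ h => ⟨h.1, h.2.2⟩

/-- `IrregularityAtLeast K τ₁ Q Γ k` says that `holInvariantForms τ₁ Q Γ` contains `k` linearly
independent vectors. -/
theorem irregularityAtLeast_iff (τ₁ : K →+* ℂ) (Q : Matrix (Fin 3) (Fin 3) ℂ)
    (Γ : Set (GL (Fin 3) K)) (k : ℕ) :
    IrregularityAtLeast K τ₁ Q Γ k ↔
      ∃ q : Fin k → holInvariantForms τ₁ Q Γ, LinearIndependent ℂ q := by
  constructor
  · rintro ⟨q, hq, hqi⟩
    refine ⟨fun i => ⟨q i, (hqi i).1, (hqi i).2⟩, ?_⟩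
    exact LinearIndependent.of_comp (holInvariantForms τ₁ Q Γ).subtype hq
  · rintro ⟨q, hq⟩
    exact ⟨fun i => (q i : (Fin 2 → ℂ) → Fin 2 → ℂ),
      hq.map' (holInvariantForms τ₁ Q Γ).subtype (Submodule.ker_subtype _),
      fun i => ⟨(q i).2.1, (q i).2.2⟩⟩

/-- `NonVanishingInput`, restated: a finite-index `Γ ≤ Γ_1` and two closed invariant forms with
non-zero wedge. -/
theorem nonVanishingInput_iff [NumberField K] [NumberField.IsCMField K] (τ₁ : K →+* ℂ)
    (H : Matrix (Fin 3) (Fin 3) K) (𝔪 : Submodule ℤ (Fin 3 → K)) (Q : Matrix (Fin 3) (Fin 3) ℂ) :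
    NonVanishingInput K τ₁ H 𝔪 Q ↔
      ∃ Γ, IsFiniteIndexSubgroupOf K Γ (shimuraLevel K H 𝔪 1) ∧
        ∃ q₁ ∈ closedInvariantForms τ₁ Q Γ, ∃ q₂ ∈ closedInvariantForms τ₁ Q Γ,
          WedgeNonzero q₁ q₂ := by
  constructor
  · rintro ⟨Γ, hΓ, q₁, q₂, h₁, h₂, c₁, c₂, i₁, i₂, w⟩
    exact ⟨Γ, hΓ, q₁, ⟨h₁, c₁, i₁⟩, q₂, ⟨h₂, c₂, i₂⟩, w⟩
  · rintro ⟨Γ, hΓ, q₁, ⟨h₁, c₁, i₁⟩, q₂, ⟨h₂, c₂, i₂⟩, w⟩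
    exact ⟨Γ, hΓ, q₁, q₂, h₁, h₂, c₁, c₂, i₁, i₂, w⟩

end Spaces

section Wedge

/-! ### `WedgeNonzero` depends only on the plane spanned, and forces independence -/

/-- `WedgeNonzero` is preserved by an invertible change of basis. -/
theorem wedgeNonzero_smul_add {q₁ q₂ : (Fin 2 → ℂ) → Fin 2 → ℂ} (a b c d : ℂ)
    (hdet : a * d - b * c ≠ 0) (h : WedgeNonzero q₁ q₂) :
    WedgeNonzero (a • q₁ + b • q₂) (c • q₁ + d • q₂) := by
  obtain ⟨z, hz, hw⟩ := h
  refine ⟨z, hz, ?_⟩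
  simp only [Pi.add_apply, Pi.smul_apply, smul_eq_mul]
  have e : (a * q₁ z 0 + b * q₂ z 0) * (c * q₁ z 1 + d * q₂ z 1) -
      (a * q₁ z 1 + b * q₂ z 1) * (c * q₁ z 0 + d * q₂ z 0) =
      (a * d - b * c) * (q₁ z 0 * q₂ z 1 - q₁ z 1 * q₂ z 0) := by ring
  rw [e]
  exact mul_ne_zero hdet hw

/-- `WedgeNonzero` is symmetric. -/
theorem WedgeNonzero.symm {q₁ q₂ : (Fin 2 → ℂ) → Fin 2 → ℂ} (h : WedgeNonzero q₁ q₂) :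
    WedgeNonzero q₂ q₁ := by
  obtain ⟨z, hz, hw⟩ := h
  refine ⟨z, hz, ?_⟩
  intro h0
  apply hw
  linear_combination -h0

/-- Two 1-forms with non-zero wedge are linearly independent. -/
theorem WedgeNonzero.linearIndependent {q₁ q₂ : (Fin 2 → ℂ) → Fin 2 → ℂ}
    (h : WedgeNonzero q₁ q₂) : LinearIndependent ℂ ![q₁, q₂] := by
  obtain ⟨z, hz, hw⟩ := h
  rw [LinearIndependent.pair_iff]
  intro s t hst
  have e0 := congrFun (congrFun hst z) 0
  have e1 := congrFun (congrFun hst z) 1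
  simp only [Pi.add_apply, Pi.smul_apply, smul_eq_mul, Pi.zero_apply] at e0 e1
  have hs : s * (q₁ z 0 * q₂ z 1 - q₁ z 1 * q₂ z 0) = 0 := by
    linear_combination q₂ z 1 * e0 - q₂ z 0 * e1
  have ht : t * (q₁ z 0 * q₂ z 1 - q₁ z 1 * q₂ z 0) = 0 := by
    linear_combination q₁ z 0 * e1 - q₁ z 1 * e0
  exact ⟨(mul_eq_zero.1 hs).resolve_right hw, (mul_eq_zero.1 ht).resolve_right hw⟩

variable {K : Type*} [Field K] [NumberField K] [NumberField.IsCMField K]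

/-- **`NonVanishingInput` gives irregularity `≥ 2` on a finite-index subgroup of `Γ_1`.** -/
theorem NonVanishingInput.exists_irregularityAtLeast_two {τ₁ : K →+* ℂ}
    {H : Matrix (Fin 3) (Fin 3) K} {𝔪 : Submodule ℤ (Fin 3 → K)} {Q : Matrix (Fin 3) (Fin 3) ℂ}
    (h : NonVanishingInput K τ₁ H 𝔪 Q) :
    ∃ Γ, IsFiniteIndexSubgroupOf K Γ (shimuraLevel K H 𝔪 1) ∧ IrregularityAtLeast K τ₁ Q Γ 2 := by
  obtain ⟨Γ, hΓ, q₁, q₂, h₁, h₂, _, _, i₁, i₂, w⟩ := h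
  refine ⟨Γ, hΓ, ![q₁, q₂], w.linearIndependent, fun i => ?_⟩
  fin_cases i
  · exact ⟨h₁, i₁⟩
  · exact ⟨h₂, i₂⟩

end Wedge

end Summit.Ventures.HodgeRepro2.ShimuraData
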